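import Mathlib
import Summits.HodgeConjecture.FermatCycles.HodgeFermatTheoremUPlus
import Summits.HodgeConjecture.FermatCycles.HodgeFermatTheoremUEq
import Summits.HodgeConjecture.FermatCycles.HodgeFermatD6OneFile
import Summits.HodgeConjecture.FermatCycles.HodgeFermatTheoremKRC
import Summits.HodgeConjecture.FermatCycles.HodgeFermatTheoremZ3UB
import Summits.HodgeConjecture.FermatCycles.HodgeFermatPropDPrimeNB
import Summits.HodgeConjecture.FermatCycles.HodgeFermatThmFstarN
import Summits.HodgeConjecture.FermatCycles.HodgeFermatPropDPrimeNStatement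

/-!
# THE UNCONDITIONAL ASSEMBLY — THEOREM U⁺ / U⁼ (`HodgeFermat/TheoremUPlusFinal.lean`, `TheoremUEqFinal.lean`; HF-G26, HF-G27), THEOREM KR6 (`TheoremKRFinal.lean`; HF-G28), THEOREM Z3U (`TheoremZ3UFinal.lean`; HF-G29), PROPOSITION D′(3N) and THE DESCENT — THEOREM F* of DPRIME §9 IN FULL (`PropDPrimeNFinal.lean`; HF-G34); closes the statement `PropDPrime3N`

Tree copy of 5 SMALL MODULES of the sibling cell's standalone package `run/shared/lean/pub/pub-hodgefermat/lean/HodgeFermat/`,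
concatenated IN DEPENDENCY ORDER in one tree file (one gate round-trip instead of 5; the hub's import-level build backlog was ≈ 50 min
per level when this file was assembled) — each module's body byte-identical to its source lines, its own `namespace … end` block kept:
  1. `HodgeFermat/TheoremUPlusFinal.lean` (34 lines, sha256 `dd6f04efb5b4dc0d…`), whole module, source lines 17–34 (all: `hypWPlus`, `thmUPlus : ThmUPlus` — THEOREM U⁺ unconditionally —, `thmUOdd′`, `hypWOdd′`) — pub-hodgefermat `CERT.md` l.909, GATE HF-G26;
  2. `HodgeFermat/TheoremUEqFinal.lean` (38 lines, sha256 `34ab25b29e3d4c8b…`), whole module, source lines 18–38 (all: `thmUPlus′_iff`, `thmUEq : ThmUEq` — THEOREM U⁼ unconditionally —, `thmUEqMultiset`, `eqAt`) — pub-hodgefermat `CERT.md` l.912, GATE HF-G27;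
  3. `HodgeFermat/TheoremKRFinal.lean` (49 lines, sha256 `efed46d796b22867…`), whole module, source lines 25–49 (all: `kr6 : KR6`, `kr6Multiset`, `krAt` — THEOREM KR6 unconditionally) — pub-hodgefermat `CERT.md` l.927, GATE HF-G28;
  4. `HodgeFermat/TheoremZ3UFinal.lean` (71 lines, sha256 `e8a6ba027896d036…`), whole module, source lines 25–71 (all: `kr6′ : KR6′`, `z3u : Z3U`, `z3uShape`, `z3uAt`, `z3uShapeAt`, `no_Z3U_of_ne` — THEOREM Z3U unconditionally) — pub-hodgefermat `CERT.md` l.933, GATE HF-G29;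
  5. `HodgeFermat/PropDPrimeNFinal.lean` (85 lines, sha256 `2c8127236a8cb233…`), whole module + the closing theorem, source lines 26–85 (all: `fstar`, `thmUPlus′`, `propDprime`, `descent`, `noCoincidence`, `noCoincidence′` — no hypotheses) + `propDprime3N_holds : PropDPrime3N` — pub-hodgefermat `CERT.md` l.990, GATE HF-G34; the sibling composes hub-checked records `check/PropDPrimeN_link_standalone.lean` + `check/DecodingDPrime_part1_standalone.lean` and builds this module by `lake build` only;
Filed by cell `pub-hfermat`, seat prover-1 gen-3, on the COORDINATOR KEEPER RULING of 2026-08-25 (gem sweep H1: take the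
off-gate kernel theorem `thmFstar` through the gate) — here THEOREM F* of `tables/DPRIME-THEOREM.md` §9 IN FULL, i.e.
PROPOSITION D′(3N) and the descent (`HodgeFermat/PropDPrimeNFinal.lean`, GATE HF-G34), the last off-gate form of THEOREM F*
(its first two forms, `DecodingFinal.thmFstar` = F* at the prime levels and `ThmFstarNFinal.thmFstar` = F*(3N), landed on
2026-08-25 as `HodgeFermatThmFstar.lean` / `HodgeFermatThmFstarN.lean`, seats prover-1 gen-0 / gen-2); these modules are the LAST links — the file closes the statement `PropDPrime3N` — of
the import closure of `PropDPrimeNFinal.propDprime` (the sibling's KR-free chain: THEOREM L, COROLLARY M, THEOREM D6,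
THEOREM U⁺, THEOREM KR6, THEOREM Z3U) on top of those landed chains.  Each source module is the sibling's module of record named in item 1–5 above; declarations are copied VERBATIM.
Deviations from the source modules, exhaustively: the `import` lines (tree modules `Summits.HodgeConjecture.FermatCycles.HodgeFermat*`
instead of `HodgeFermat.*`, hoisted to the top; the source `import` lines between the concatenated modules are dropped); this docstring
(replacing the modules' docstrings, all quoted below); none at file level beyond the concatenation itself; per module: (`import …HodgeFermatTheoremUPlus` / `…HodgeFermatD6OneFile` stand for the sources' imports of `TheoremUPlus`, `HypUPlusFinal` / `D6OneFile`, those modules being in these tree files)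
  — module 1 (`TheoremUPlusFinal.lean`): one-line docstrings added (gate lint) to `hypWOdd'`.
  — module 2 (`TheoremUEqFinal.lean`): none besides these.
  — module 3 (`TheoremKRFinal.lean`): DEDUP (pre-empting the gate's `dedup.landed`): the source's `theorem d6_again : D6` (l.46–47, THEOREM D6 re-derived from KR6, used nowhere) has exactly the statement of `HodgeFermat.KRFree.OneFile.theoremD6` (`HodgeFermatD6OneFile.lean`) and is DELETED.
  — module 4 (`TheoremZ3UFinal.lean`): none besides these.
  — module 5 (`PropDPrimeNFinal.lean`): `import …HodgeFermatThmFstarN` (the landed tree file of `ThmFstarNFinal.thmFstar`, seat prover-1 gen-2) replaces the source's `import HodgeFermat.ThmFstarNFinal`; AFTER the source's last declaration and before its `end` line ONE theorem is added: `propDprime3N_holds : PropDPrime3N` — the statement filed first (`HodgeFermatPropDPrimeNStatement.lean`, the universal closure of `propDprime`'s signature) closed by `propDprime` itself (a λ re-packaging of the binders, no other content).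
Every other line — in particular every declaration's statement and proof — is byte-identical to its source.
HONEST FRAMING: explicit algebraic cycles for specific Hodge classes on Fermat/Delsarte varieties; residual open instances
listed; no claim on general Hodge.  (This file is arithmetic of CM types / finite combinatorics / analytic number theory
of the sibling's KR-free programme; it claims nothing about cycles.)

(1) The docstring of `HodgeFermat/TheoremUPlusFinal.lean` (l.7–15), verbatim:

## LEMMA W and THEOREM U⁺ at every odd level `N ∉ {21, 39}` — unconditional (HF-G26)

`thmUPlus : ThmUPlus` (two all-unit triples of the same CM type at ANY odd level `N ∉ {21, 39}` share an entry
mod `N`), `hypWPlus : HypWPlus` (LEMMA W there): the light chain `TheoremUPlus.thmUPlus_of` applied to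
`HypUPlusFinal.goodOddP`.  The generation-25 theorems `thmUOdd`, `hypWOdd` become corollaries (`thmUOdd'`, `hypWOdd'`).
Hub record: the light file `check/ThmUPlusLight_standalone.lean` + the three range records + the link check
`check/ThmUPlusLink_standalone.lean` (`--axioms thmUPlus` = the three + exactly the three range statements).

(2) The docstring of `HodgeFermat/TheoremUEqFinal.lean` (l.7–16), verbatim:

## THEOREM U, EQUALITY FORM — unconditional at every odd level `N ∉ {21, 39}` (HF-G27)

`thmUEq : ThmUEq` (two all-unit triples of the same CM type are permutations of each other mod `N`) and its
multiset form `thmUEqMultiset : ThmUEqMultiset` (`{a, b, c} = {a', b', c'}` in `ℤ/N`): the light combinatorial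
upgrade `TheoremUEq.thmUEq_of_thmUPlus'` applied to generation 26's unconditional `HypUPlus.thmUPlus`, after the
syntactic identity `ThmUPlus' ↔ ThmUPlus` (`Iff.rfl`: the hypothesis of the light module IS generation 26's theorem).
Hub record: `check/TheoremUEq_standalone.lean` + generation 26's records of `thmUPlus` + the link check
`check/ThmUEqLink_standalone.lean` (`--axioms thmUEq` = the three + exactly `HypUPlus.thmUPlus`).

(3) The docstring of `HodgeFermat/TheoremKRFinal.lean` (l.7–23), verbatim:

## THEOREM KR6 — unconditional (HF-G28)

`kr6 : KR6` — **at a squarefree level `N` prime to `6`, two triples of level `N` (zero sum, no entry `≡ 0`; entries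
divisible by primes of `N` allowed; shared entries allowed) with the same CM type are permutations of each other
mod `N`** — i.e. the conclusion of Koblitz–Rohrlich's Theorem 1 at these levels, with no imported input: from
`TheoremKR.kr6_of_W : HypW → KR6` (generation 28) and LEMMA W `OneFile.hypW : HypW` (generation 24, `D6OneFile.lean`:
HYPOTHESIS U by the kernel walk to `3·10⁴` and the analytic tail, then B ⇒ W).  Multiset form `kr6Multiset`.
Hub records: `check/KR6_standalone.lean` (the 13 bodies of `check/TheoremU_standalone.lean` + `TheoremUEq` + `TheoremKR`;
`--axioms …kr6_of_W` = the three) and the link check `check/KR6Link_standalone.lean` (the same bodies, `OneFile.hypW`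
POSTULATED with a citation of its generation-24 record `check/D6OneFile_standalone.lean`, then this module verbatim:
`--axioms HodgeFermat.KRFree.TheoremKR.kr6` = the three + exactly `HodgeFermat.KRFree.OneFile.hypW`).  The CLOSED one-file
form `check/KR6OneFile_standalone.lean` (the 22 bodies of `D6OneFile_standalone.lean` + `TheoremUEq` + `TheoremKR` + this
module under one `import Mathlib`, nothing postulated) is shipped too; its serial elaboration (≈ 10 min) exceeds what the
hub farm certifies under load (tree retention, `GATE.md` § HF-G28) — the certified record is the pair above + the link.
COROLLARY D6′ of `tables/KR-FREE.md` §7 no longer imports Aoki–Shioda.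

(4) The docstring of `HodgeFermat/TheoremZ3UFinal.lean` (l.7–23), verbatim:

## THEOREM Z3U — unconditional (HF-G29)

`z3u : Z3U` — **a jointly primitive coincidence of CM types at a squarefree level `m = 3n` (`n` odd) whose pattern
at the prime `3` is (Z3, U) — one triple divisible by `3`, the other all units at `3` — has `m = 21`**
(`tables/DPRIME-THEOREM.md` §4, THEOREM Z3U), together with its shape form `z3uShape : Z3UShape` (no primitivity:
`7 ∣ n` and the pair is `(n/7)` times a pair of level `21`), with no imported input: `TheoremZ3U.z3u_of_kr6 : KR6' → Z3U`
(this generation's light module: LEMMA N at `p = 3`, the `−3̄`-stability of the CM type one level down, and the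
trichotomy for a unit permuting a triple) applied to THEOREM KR6 `TheoremKR.kr6` (generation 28, `TheoremKRFinal.lean`:
`kr6_of_W` + LEMMA W `OneFile.hypW` of generation 24) — `KR6'` is the verbatim copy of `TheoremKR.KR6`, so the two
`Prop`s are syntactically equal and the hypothesis is discharged by `kr6` itself.
Hub records: `check/Z3U_standalone.lean` (`LemmaN`, `LemmaO`, `TheoremLRows`, `TheoremUEq`, `TheoremZ3U`;
`--axioms …z3u_of_kr6` = the three) and the link check `check/Z3ULink_standalone.lean` (the same bodies, the statements
`TheoremKR.KR6` and `TheoremD6.JP` excerpted verbatim and `TheoremKR.kr6` POSTULATED with a citation of its generation-28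
records `check/KR6_standalone.lean` + `check/KR6Link_standalone.lean`, then this module verbatim:
`--axioms HodgeFermat.KRFree.TheoremZ3U.z3u` = the three + exactly `HodgeFermat.KRFree.TheoremKR.kr6`); `GATE.md` § HF-G29.

(5) The docstring of `HodgeFermat/PropDPrimeNFinal.lean` (l.9–24), verbatim:

## PROPOSITION D′(3N) and THE DESCENT — unconditional (HF-G34; `lake build` form)

`PropDPrimeN.propDprime` / `descent` / `noCoincidence` (COROLLARY M side: hypotheses `KR6'`, `ThmUPlus'`, and THEOREM
F\*(3N) as `Fstar`) composed with the three theorems that discharge them: THEOREM KR6 `TheoremZ3U.kr6'`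
(`TheoremZ3UFinal`, generation 29 ← 28 ← 24), THEOREM U⁺ `HypUPlus.thmUPlus` (`TheoremUPlusFinal`, generation 26) through the
syntactic identity `TheoremUEq.thmUPlus'_iff` (`TheoremUEqFinal`), and THEOREM F\*(3N) `ThmFstarNFinal.thmFstar` (generation 33).
The result has NO hypotheses: THEOREM F\* of `tables/DPRIME-THEOREM.md` §9 in full.  The import closure of this module is the
union of the COROLLARY M cone, the analytic chain of THEOREM F\*(3N), LEMMA W (`OneFile`) and the range records of
HYPOTHESIS U⁺; its one-file concatenation exceeds the hub's 512 KiB cap many times over, so — exactly as `DecodingFinal`,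
`DPrimePrimeFinal`, `ThmFstarNFinal` — it has NO hub record of its own: it is a composition of hub-checked records
(`check/PropDPrimeN_link_standalone.lean` + `check/DecodingDPrime_part1_standalone.lean`; `check/ThmFstarN_link_standalone.lean`
+ `check/HypVRange_standalone.lean`; the records of `kr6'` and `thmUPlus` listed in `GATE.md` § HF-G29, HF-G26), whose SHAPE was
elaborated on the hub against stand-in axioms with the verbatim statements (seat scratch `ShapeFinal_g34`), and which is
checked as a whole by `lake build HodgeFermat.PropDPrimeNFinal` only.  NOT imported by the root `HodgeFermat.lean`.
-/

/-! ## (1/5) `HodgeFermat/TheoremUPlusFinal.lean` — source lines 17–34 -/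

set_option autoImplicit false

namespace HodgeFermat.KRFree.HypUPlus

open HodgeFermat.KRFree.HypUOdd

/-- LEMMA W at every odd level `N > 1`, `N ∉ {21, 39}` — no hypotheses. -/
theorem hypWPlus : HypWPlus := hypWPlus_of goodOddP

/-- **THEOREM U⁺** at every odd level `N ∉ {21, 39}` — no hypotheses. -/
theorem thmUPlus : ThmUPlus := thmUPlus_of goodOddP

/-- the generation-25 statements as corollaries. -/
theorem thmUOdd' : ThmUOdd := thmUOdd_of_thmUPlus thmUPlus

/-- LEMMA W at the odd squarefree levels, unconditionally (corollary) -/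
theorem hypWOdd' : HypWOdd := hypWOdd_of_hypWPlus hypWPlus

end HodgeFermat.KRFree.HypUPlus

/-! ## (2/5) `HodgeFermat/TheoremUEqFinal.lean` — source lines 18–38 -/

set_option autoImplicit false

namespace HodgeFermat.KRFree.TheoremUEq

open HodgeFermat.KRFree.HypUPlus

/-- the verbatim copy `ThmUPlus'` of the light module IS generation 26's `ThmUPlus` (syntactic identity). -/
theorem thmUPlus'_iff : ThmUPlus' ↔ ThmUPlus := Iff.rfl

/-- **THEOREM U, EQUALITY FORM** — no hypotheses: at every odd level `N ∉ {21, 39}`, two triples of units mod `N`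
with `N ∣ a + b + c`, `N ∣ a' + b' + c'` and the same CM type are permutations of each other as residues mod `N`. -/
theorem thmUEq : ThmUEq := thmUEq_of_thmUPlus' (thmUPlus'_iff.mpr thmUPlus)

/-- **THEOREM U, MULTISET FORM** — no hypotheses: `{a, b, c} = {a', b', c'}` in `ℤ/N`. -/
theorem thmUEqMultiset : ThmUEqMultiset := thmUEqMultiset_of thmUEq

/-- the level-wise form. -/
theorem eqAt (N : ℕ) (h2 : ¬ 2 ∣ N) (h21 : N ≠ 21) (h39 : N ≠ 39) : EqAt N :=
  eqAt_of_shareAt (shareAt_of_thmUPlus' (thmUPlus'_iff.mpr thmUPlus) N h2 h21 h39)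

end HodgeFermat.KRFree.TheoremUEq

/-! ## (3/5) `HodgeFermat/TheoremKRFinal.lean` — source lines 25–49 -/

set_option autoImplicit false

namespace HodgeFermat.KRFree.TheoremKR

open HodgeFermat.KRFree HodgeFermat.KRFree.LemmaN HodgeFermat.KRFree.TheoremD6 HodgeFermat.KRFree.TheoremU
open HodgeFermat.KRFree.TheoremUEq (Perm3)

/-- **THEOREM KR6** (no binders): a coincidence of CM types at a squarefree level prime to `6` is trivial. -/
theorem kr6 : KR6 := kr6_of_W OneFile.hypW

/-- … as an equality of multisets `{a, b, c} = {a', b', c'}` in `ℤ/N`. -/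
theorem kr6Multiset : KR6Multiset := kr6Multiset_of_W OneFile.hypW

/-- the level-`N` statement, spelled out. -/
theorem krAt (N a b c a' b' c' : ℕ) (hsq : Squarefree N) (h2 : ¬ 2 ∣ N) (h3 : ¬ 3 ∣ N)
    (hs : N ∣ a + b + c) (hs' : N ∣ a' + b' + c')
    (ha : ¬ N ∣ a) (hb : ¬ N ∣ b) (hc : ¬ N ∣ c) (ha' : ¬ N ∣ a') (hb' : ¬ N ∣ b') (hc' : ¬ N ∣ c')
    (hT : SameType N (a, b, c) (a', b', c')) :
    Perm3 (a % N) (b % N) (c % N) (a' % N) (b' % N) (c' % N) :=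
  kr6 N a b c a' b' c' hsq h2 h3 hs hs' ha hb hc ha' hb' hc' hT
-- `d6_again : D6` (source l.45–47, THEOREM D6 recovered from KR6): DELETED — same statement as the landed `OneFile.theoremD6` (gate dedup); unused.

end HodgeFermat.KRFree.TheoremKR

/-! ## (4/5) `HodgeFermat/TheoremZ3UFinal.lean` — source lines 25–71 -/

set_option autoImplicit false

namespace HodgeFermat.KRFree.TheoremZ3U

open HodgeFermat.KRFree.LemmaN
open HodgeFermat.KRFree.TheoremD6 (JP)

/-- the hypothesis of the light module IS THEOREM KR6: the two statements are syntactically equal. -/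
theorem kr6' : KR6' := TheoremKR.kr6

/-- **THEOREM Z3U** (no binders): a jointly primitive (Z3, U)-at-3 coincidence at a squarefree level `3n` has `3n = 21`. -/
theorem z3u : Z3U := z3u_of_kr6 kr6'

/-- **THEOREM Z3U, shape form** (no binders): without primitivity, `7 ∣ n` and `n / 7` divides all six entries
`a, b, c, x, y, z` of the pair `(3a, 3b, 3c) ∼ (x, y, z)`. -/
theorem z3uShape : Z3UShape := z3uShape_of_kr6 kr6'

/-- the level-`3n` statement spelled out, joint primitivity as `TheoremD6.JP` (no prime of the level divides all six
entries). -/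
theorem z3uAt (n a b c x y z : ℕ) (hsq : Squarefree (3 * n)) (h2 : ¬ 2 ∣ n)
    (hs : 3 * n ∣ 3 * a + 3 * b + 3 * c) (hs' : 3 * n ∣ x + y + z)
    (ha : ¬ 3 * n ∣ 3 * a) (hb : ¬ 3 * n ∣ 3 * b) (hc : ¬ 3 * n ∣ 3 * c)
    (hx : ¬ 3 ∣ x) (hy : ¬ 3 ∣ y) (hz : ¬ 3 ∣ z)
    (hjp : JP (3 * n) (3 * a, 3 * b, 3 * c) (x, y, z))
    (hH : SameType (3 * n) (3 * a, 3 * b, 3 * c) (x, y, z)) : 3 * n = 21 :=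
  z3u n a b c x y z hsq h2 hs hs' ha hb hc hx hy hz hjp hH

/-- the shape form spelled out. -/
theorem z3uShapeAt (n a b c x y z : ℕ) (hsq : Squarefree (3 * n)) (h2 : ¬ 2 ∣ n)
    (hs : 3 * n ∣ 3 * a + 3 * b + 3 * c) (hs' : 3 * n ∣ x + y + z)
    (ha : ¬ 3 * n ∣ 3 * a) (hb : ¬ 3 * n ∣ 3 * b) (hc : ¬ 3 * n ∣ 3 * c)
    (hx : ¬ 3 ∣ x) (hy : ¬ 3 ∣ y) (hz : ¬ 3 ∣ z)
    (hH : SameType (3 * n) (3 * a, 3 * b, 3 * c) (x, y, z)) :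
    7 ∣ n ∧ n / 7 ∣ a ∧ n / 7 ∣ b ∧ n / 7 ∣ c ∧ n / 7 ∣ x ∧ n / 7 ∣ y ∧ n / 7 ∣ z :=
  z3uShape n a b c x y z hsq h2 hs hs' ha hb hc hx hy hz hH

/-- in particular (COROLLARY M's clause at the prime `3`): at a squarefree level `3n` with `n ≠ 7`, no jointly primitive
coincidence has the pattern (Z3, U) at `3`. -/
theorem no_Z3U_of_ne (n a b c x y z : ℕ) (hsq : Squarefree (3 * n)) (h2 : ¬ 2 ∣ n) (hn7 : n ≠ 7)
    (hs : 3 * n ∣ 3 * a + 3 * b + 3 * c) (hs' : 3 * n ∣ x + y + z)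
    (ha : ¬ 3 * n ∣ 3 * a) (hb : ¬ 3 * n ∣ 3 * b) (hc : ¬ 3 * n ∣ 3 * c)
    (hx : ¬ 3 ∣ x) (hy : ¬ 3 ∣ y) (hz : ¬ 3 ∣ z)
    (hjp : JP (3 * n) (3 * a, 3 * b, 3 * c) (x, y, z))
    (hH : SameType (3 * n) (3 * a, 3 * b, 3 * c) (x, y, z)) : False :=
  hn7 (by have h := z3u n a b c x y z hsq h2 hs hs' ha hb hc hx hy hz hjp hH; omega)

end HodgeFermat.KRFree.TheoremZ3U

/-! ## (5/5) `HodgeFermat/PropDPrimeNFinal.lean` — source lines 26–85 -/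

set_option autoImplicit false

namespace HodgeFermat.KRFree.PropDPrimeNFinal

open HodgeFermat.KRFree.LemmaN
open HodgeFermat.KRFree.CoincFull (InClass)
open HodgeFermat.KRFree.PropDPrimeN (Fstar units39)

/-- THEOREM F\*(3N) (generation 33, unconditional) in the curried form `Fstar` of the light module. -/
theorem fstar : Fstar :=
  fun _ _ _ _ _ _ _ hn11 hn13 hsq h11 hs hs' ha hb hc ha' hb' hc' hD hT =>
    ThmFstarNFinal.thmFstar hn11 hn13 hsq h11 hs hs' ha hb hc ha' hb' hc' hD hT

/-- THEOREM U⁺ (generation 26, unconditional) in the primed form of the light modules. -/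
theorem thmUPlus' : TheoremUEq.ThmUPlus' := TheoremUEq.thmUPlus'_iff.mpr HypUPlus.thmUPlus

/-- **PROPOSITION D′(3N)** — no hypotheses.  `N` squarefree with all prime factors `≥ 11`, `N ≠ 13`; two disjoint, jointly
primitive zero-sum triples mod `3N` with no entry `≡ 0 (mod 3N)` do not have the same CM type at level `3N`. -/
theorem propDprime {N : ℕ} (hN : 0 < N) (hsq : Squarefree N) (h11 : ∀ p ∈ N.primeFactors, 11 ≤ p) (hN13 : N ≠ 13)
    {a b c a' b' c' : ℕ}
    (hs : 3 * N ∣ a + b + c) (ha : ¬ 3 * N ∣ a) (hb : ¬ 3 * N ∣ b) (hc : ¬ 3 * N ∣ c)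
    (hs' : 3 * N ∣ a' + b' + c') (ha' : ¬ 3 * N ∣ a') (hb' : ¬ 3 * N ∣ b') (hc' : ¬ 3 * N ∣ c')
    (hJ : ∀ q, Nat.Prime q → q ∣ 3 * N → q ∣ a → q ∣ b → q ∣ c → q ∣ a' → q ∣ b' → q ∣ c' → False)
    (hD : ∀ u v, (u = a ∨ u = b ∨ u = c) → (v = a' ∨ v = b' ∨ v = c') → ¬ u ≡ v [MOD 3 * N])
    (hH : SameType (3 * N) (a, b, c) (a', b', c')) : False :=
  PropDPrimeN.propDprime TheoremZ3U.kr6' thmUPlus' fstar hN hsq h11 hN13 hs ha hb hc hs' ha' hb' hc' hJ hD hH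

/-- **THE DESCENT — THEOREM F\* in full** — no hypotheses.  `N > 0` squarefree with all prime factors `≥ 11`; two disjoint
zero-sum triples mod `3N`, no entry `≡ 0 (mod 3N)`, of the same CM type: `N = 13·g`, `g` divides all six entries, and the pair
divided by `g` reduces mod `39` into one of the two all-unit classes `PropDPrimeN.units39` of level `39` — the pair is `g` times one of the
twelve disjoint coincidences of THEOREM D′. -/
theorem descent {N : ℕ} (hN : 0 < N) (hsq : Squarefree N) (h11 : ∀ p ∈ N.primeFactors, 11 ≤ p) {a b c a' b' c' : ℕ}
    (hs : 3 * N ∣ a + b + c) (ha : ¬ 3 * N ∣ a) (hb : ¬ 3 * N ∣ b) (hc : ¬ 3 * N ∣ c)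
    (hs' : 3 * N ∣ a' + b' + c') (ha' : ¬ 3 * N ∣ a') (hb' : ¬ 3 * N ∣ b') (hc' : ¬ 3 * N ∣ c')
    (hD : ∀ u v, (u = a ∨ u = b ∨ u = c) → (v = a' ∨ v = b' ∨ v = c') → ¬ u ≡ v [MOD 3 * N])
    (hH : SameType (3 * N) (a, b, c) (a', b', c')) :
    ∃ g, N = 13 * g ∧ g ∣ a ∧ g ∣ b ∧ g ∣ c ∧ g ∣ a' ∧ g ∣ b' ∧ g ∣ c' ∧
      ∃ cl ∈ units39, InClass cl (a / g % 39) (b / g % 39) (c / g % 39) ∧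
        InClass cl (a' / g % 39) (b' / g % 39) (c' / g % 39) :=
  PropDPrimeN.descent TheoremZ3U.kr6' thmUPlus' fstar hN hsq h11 hs ha hb hc hs' ha' hb' hc' hD hH

/-- **No disjoint coincidence at level `3N`, `13 ∤ N`** — no hypotheses. -/
theorem noCoincidence {N : ℕ} (hN : 0 < N) (hsq : Squarefree N) (h11 : ∀ p ∈ N.primeFactors, 11 ≤ p) (h13 : ¬ 13 ∣ N)
    {a b c a' b' c' : ℕ}
    (hs : 3 * N ∣ a + b + c) (ha : ¬ 3 * N ∣ a) (hb : ¬ 3 * N ∣ b) (hc : ¬ 3 * N ∣ c)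
    (hs' : 3 * N ∣ a' + b' + c') (ha' : ¬ 3 * N ∣ a') (hb' : ¬ 3 * N ∣ b') (hc' : ¬ 3 * N ∣ c')
    (hD : ∀ u v, (u = a ∨ u = b ∨ u = c) → (v = a' ∨ v = b' ∨ v = c') → ¬ u ≡ v [MOD 3 * N])
    (hH : SameType (3 * N) (a, b, c) (a', b', c')) : False :=
  PropDPrimeN.noCoincidence TheoremZ3U.kr6' thmUPlus' fstar hN hsq h11 h13 hs ha hb hc hs' ha' hb' hc' hD hH

/-- the same with the hypotheses on `N` in divisibility form (`N` squarefree, prime to `210`, `13 ∤ N`) — no hypotheses. -/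
theorem noCoincidence' {N : ℕ} (hN : 0 < N) (hsq : Squarefree N) (h2 : ¬ 2 ∣ N) (h3 : ¬ 3 ∣ N) (h5 : ¬ 5 ∣ N) (h7 : ¬ 7 ∣ N)
    (h13 : ¬ 13 ∣ N) {a b c a' b' c' : ℕ}
    (hs : 3 * N ∣ a + b + c) (ha : ¬ 3 * N ∣ a) (hb : ¬ 3 * N ∣ b) (hc : ¬ 3 * N ∣ c)
    (hs' : 3 * N ∣ a' + b' + c') (ha' : ¬ 3 * N ∣ a') (hb' : ¬ 3 * N ∣ b') (hc' : ¬ 3 * N ∣ c')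
    (hD : ∀ u v, (u = a ∨ u = b ∨ u = c) → (v = a' ∨ v = b' ∨ v = c') → ¬ u ≡ v [MOD 3 * N])
    (hH : SameType (3 * N) (a, b, c) (a', b', c')) : False :=
  PropDPrimeN.noCoincidence' TheoremZ3U.kr6' thmUPlus' fstar hN hsq h2 h3 h5 h7 h13 hs ha hb hc hs' ha' hb' hc' hD hH

/-- **PROPOSITION D′(3N) — THEOREM F\* of DPRIME §9 in full — holds**: the statement `PropDPrime3N` filed first
(`HodgeFermatPropDPrimeNStatement.lean`, count-neutral) is closed by `propDprime` above (binders re-packaged, nothing else).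
Unconditional: no hypothesis beyond the binders of the statement; axioms = [propext, Classical.choice, Quot.sound]. -/
theorem propDprime3N_holds : PropDPrime3N :=
  fun _ hN hsq h11 hN13 _ _ _ _ _ _ hs ha hb hc hs' ha' hb' hc' hJ hD hH =>
    propDprime hN hsq h11 hN13 hs ha hb hc hs' ha' hb' hc' hJ hD hH

end HodgeFermat.KRFree.PropDPrimeNFinal
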